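import Literature.NumberTheory.Automorphic.LeviDetOne
import HarnessLib

/-!
# `L = L° · R · Z(L)` with `R` finite, for the standard Levi of `GL_n(F)`

For the standard Levi `L = Π_a GL(B_a, F)` (`c : Fin n → Fin r`) over a non-archimedean local
field and its open normal subgroup `L° = {|det_a| = 1}` (`LeviDetOne`), we prove the
decomposition **`L = L° · R · Z(L)` with a finite set `R`**
(`exists_finset_forall_eq_leviDetOne_mul_mul_center`): writing `|det g_a| = |ϖ|^{k_a}` and
`k_a = n_a q_a + r_a` (`0 ≤ r_a < n_a`), `g = h · diag(ϖ^{r_a} at the first index of each block)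
· diag(ϖ^{q_a} 1_{B_a})` with `h ∈ L°` and the last factor central. This is the `GL`-avatar of
"`G°Z` has finite index in `G`" (Bernstein–Zelevinsky 1976, §3.3; Bushnell–Henniart 2006, §10).
We also record that the Levi is a nonarchimedean topological group (`nonarchimedeanGroup_levi`,
from `nonarchimedeanGroup_gl` block by block). Theorems only; no definitions, no named facts.

## References

* I. N. Bernstein, A. V. Zelevinsky, *Representations of the group `GL(n, F)` where `F` is a
  non-archimedean local field*, Russian Math. Surveys 31:3 (1976), §3.3.
* C. J. Bushnell, G. Henniart, *The local Langlands conjecture for `GL(2)`* (2006), §10.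
-/

noncomputable section

open scoped MatrixGroups
open Matrix ValuativeRel

namespace Literature.NumberTheory.Automorphic

section Torus

variable {F : Type*} [Field F] {n r : ℕ} (c : Fin n → Fin r) {ϖ : F} (hϖ : ϖ ≠ 0)

include hϖ in
/-- `∏ ϖ^{e i} = ϖ^{∑ e i}` in a field (`ϖ ≠ 0`); a private copy of the helper of
`SatakeParametersGLXiRecursion` (not imported: unrelated heavy file). [folklore] -/
private theorem prod_zpow_eq_zpow_sum_aux {ι : Type*} (s : Finset ι) (e : ι → ℤ) :
    ∏ i ∈ s, ϖ ^ e i = ϖ ^ ∑ i ∈ s, e i := by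
  classical
  induction s using Finset.induction_on with
  | empty => simp
  | insert a s ha ih => rw [Finset.prod_insert ha, Finset.sum_insert ha, ih, zpow_add₀ hϖ]

/-- The determinant of the `a`-th block of `diag(ϖ^e)` is `ϖ^{∑_{i ∈ B_a} e i}`. [folklore] -/
theorem det_leviZpowDiag_apply (e : Fin n → ℤ) (a : Fin r) :
    (Units.val (leviZpowDiag c hϖ e a)).det = ϖ ^ ∑ i : {i // c i = a}, e i.1 := by
  rw [coe_leviZpowDiag_apply, Matrix.det_diagonal, prod_zpow_eq_zpow_sum_aux hϖ]

variable [ValuativeRel F]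

/-- `|det (diag(ϖ^e))_a| = |ϖ|^{∑_{B_a} e}`. [folklore] -/
theorem valuation_det_leviZpowDiag_apply (e : Fin n → ℤ) (a : Fin r) :
    valuation F ((Matrix.GeneralLinearGroup.det (leviZpowDiag c hϖ e a) : Fˣ) : F) =
      valuation F ϖ ^ ∑ i : {i // c i = a}, e i.1 := by
  rw [Matrix.GeneralLinearGroup.val_det_apply, det_leviZpowDiag_apply, map_zpow₀]

end Torus

section Decomposition

variable {F : Type*} [Field F] [ValuativeRel F] [TopologicalSpace F] [IsNonarchimedeanLocalField F]
  {n r : ℕ} (c : Fin n → Fin r)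

/-- The exponent `|x| = |ϖ|^k` of a non-zero element (private helper; cf. the `IsUniformizer`
version `exists_valuation_eq_zpow_of_isUniformizer` of `TateLocalFactorsProofs`). [folklore] -/
private theorem exists_valuation_eq_valuation_zpow {ϖ : F} (hϖ : IsUniformizingElement ϖ) {x : F} (hx : x ≠ 0) :
    ∃ k : ℤ, valuation F x = valuation F ϖ ^ k := by
  obtain ⟨k, u, hu, rfl⟩ := exists_eq_zpow_mul_of_ne_zero hϖ hx
  exact ⟨k, by rw [map_mul, map_zpow₀, hu, mul_one]⟩

/-- **`L = L° · R · Z(L)` with `R` finite.** There is a finite set `R ⊆ L = Π_a GL(B_a, F)` such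
that every `g ∈ L` is `g = h l z` with `h ∈ L°`, `l ∈ R` and `z` central in `L`.
(Bernstein–Zelevinsky 1976, §3.3; Bushnell–Henniart 2006, §10: `G°Z` has finite index in `G`.)
[cite: BernsteinZelevinsky1976, §3.3] -/
theorem exists_finset_forall_eq_leviDetOne_mul_mul_center :
    ∃ R : Finset (Π a, GL {i // c i = a} F), ∀ g : Π a, GL {i // c i = a} F,
      ∃ h ∈ leviDetOne F c, ∃ l ∈ R, ∃ z ∈ Subgroup.center (Π a, GL {i // c i = a} F), g = h * l * z := by
  classical
  obtain ⟨ϖ, hϖ⟩ := exists_isUniformizingElement (F := F)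
  have hϖ0 : ϖ ≠ 0 := hϖ.ne_zero
  have hv0 : valuation F ϖ ≠ 0 := (Valuation.ne_zero_iff _).2 hϖ0
  -- the exponent vector attached to remainders `ρ a < n + 1`, supported at the first index of each block
  let firstExp : (Fin r → Fin (n + 1)) → Fin n → ℤ := fun ρ i =>
    if ((blockEnum c (c i)).symm ⟨i, rfl⟩).1 = 0 then (ρ (c i) : ℤ) else 0
  refine ⟨Finset.univ.image fun ρ => leviZpowDiag c hϖ0 (firstExp ρ), fun g => ?_⟩
  -- exponents of the block determinants
  have hk : ∀ a, ∃ k : ℤ, valuation F ((Matrix.GeneralLinearGroup.det (g a) : Fˣ) : F) = valuation F ϖ ^ k :=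
    fun a => exists_valuation_eq_valuation_zpow hϖ (Units.ne_zero _)
  choose k hk using hk
  let q : Fin r → ℤ := fun a => k a / (Fintype.card {i // c i = a} : ℤ)
  let rem : Fin r → ℤ := fun a => k a % (Fintype.card {i // c i = a} : ℤ)
  have hrem0 : ∀ a, Fintype.card {i // c i = a} ≠ 0 → 0 ≤ rem a := fun a ha =>
    Int.emod_nonneg _ (by exact_mod_cast ha)
  have hremlt : ∀ a, Fintype.card {i // c i = a} ≠ 0 → rem a < n + 1 := fun a ha => by
    have h1 : rem a < (Fintype.card {i // c i = a} : ℤ) :=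
      Int.emod_lt_of_pos _ (by exact_mod_cast Nat.pos_of_ne_zero ha)
    have h2 : Fintype.card {i // c i = a} ≤ n := by
      simpa using Fintype.card_subtype_le (fun i : Fin n => c i = a)
    omega
  let ρ : Fin r → Fin (n + 1) := fun a =>
    if ha : Fintype.card {i // c i = a} = 0 then 0 else ⟨(rem a).toNat, by
      have := hremlt a ha; have := hrem0 a ha; omega⟩
  have hρ : ∀ a, Fintype.card {i // c i = a} ≠ 0 → ((ρ a : ℕ) : ℤ) = rem a := fun a ha => by
    simp only [ρ, dif_neg ha]
    exact Int.toNat_of_nonneg (hrem0 a ha)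
  set z : Π a, GL {i // c i = a} F := leviZpowDiag c hϖ0 (fun i => q (c i)) with hz
  set l : Π a, GL {i // c i = a} F := leviZpowDiag c hϖ0 (firstExp ρ) with hl
  have hzc : z ∈ Subgroup.center (Π a, GL {i // c i = a} F) :=
    leviZpowDiag_mem_center c hϖ0 fun i j hij => by simp [hij]
  refine ⟨g * z⁻¹ * l⁻¹, ?_, l, Finset.mem_image.2 ⟨ρ, Finset.mem_univ _, rfl⟩, z, hzc, by group⟩
  -- `h = g z⁻¹ l⁻¹ ∈ L°`
  intro a
  by_cases ha : Fintype.card {i // c i = a} = 0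
  · haveI : IsEmpty {i // c i = a} := Fintype.card_eq_zero_iff.1 ha
    rw [Matrix.GeneralLinearGroup.val_det_apply, Matrix.det_isEmpty, map_one]
  -- sums of the exponents over the block `a`
  have hsumq : ∑ i : {i // c i = a}, q (c i.1) = (Fintype.card {i // c i = a} : ℤ) * q a := by
    rw [Finset.sum_congr rfl fun (i : {i // c i = a}) _ => show q (c i.1) = q a by rw [i.2], Finset.sum_const,
      Finset.card_univ, nsmul_eq_mul]
  have hsumr : ∑ i : {i // c i = a}, firstExp ρ i.1 = rem a := by
    -- only the first index of the block contributes
    have hfirst : ∀ i : {i // c i = a}, firstExp ρ i.1 =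
        if i = blockEnum c a ⟨0, Nat.pos_of_ne_zero ha⟩ then rem a else 0 := by
      intro i
      obtain ⟨i, hi⟩ := i
      subst hi
      simp only [firstExp]
      rw [← hρ (c i) ha]
      congr 1
      rw [eq_iff_iff]
      constructor
      · intro h0
        apply Subtype.ext
        have : (blockEnum c (c i)).symm ⟨i, rfl⟩ = ⟨0, Nat.pos_of_ne_zero ha⟩ := Fin.ext h0
        rw [← this, OrderIso.apply_symm_apply]
      · intro h
        have := congrArg (blockEnum c (c i)).symm h
        rw [OrderIso.symm_apply_apply] at this
        rw [this]
    simp only [hfirst, Finset.sum_ite_eq', Finset.mem_univ, if_true]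
  -- the valuation of `det h_a`
  have hdetz : valuation F ((Matrix.GeneralLinearGroup.det (z a) : Fˣ) : F) =
      valuation F ϖ ^ ((Fintype.card {i // c i = a} : ℤ) * q a) := by
    rw [hz, valuation_det_leviZpowDiag_apply, hsumq]
  have hdetl : valuation F ((Matrix.GeneralLinearGroup.det (l a) : Fˣ) : F) = valuation F ϖ ^ rem a := by
    rw [hl, valuation_det_leviZpowDiag_apply, hsumr]
  have hexp : k a + -((Fintype.card {i // c i = a} : ℤ) * q a) + -rem a = 0 := by
    have := Int.mul_ediv_add_emod (k a) (Fintype.card {i // c i = a} : ℤ)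
    simp only [q, rem] at this ⊢
    linarith
  simp only [Pi.mul_apply, Pi.inv_apply, map_mul, map_inv, Units.val_mul, Units.val_inv_eq_inv_val, map_inv₀]
  rw [hk a, hdetz, hdetl, ← _root_.zpow_neg, ← _root_.zpow_neg, ← zpow_add₀ hv0, ← zpow_add₀ hv0, hexp, zpow_zero]

end Decomposition

/-! ### The Levi is a nonarchimedean group -/

section Nonarchimedean

open Filter Topology

variable (F : Type*) [Field F] [ValuativeRel F] [TopologicalSpace F] [IsNonarchimedeanLocalField F]
  {n r : ℕ} (c : Fin n → Fin r)

/-- Each block `GL(B_a, F)` is a nonarchimedean group (transport of `nonarchimedeanGroup_gl` along the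
increasing enumeration of the block). [folklore] -/
theorem nonarchimedeanGroup_block (a : Fin r) : NonarchimedeanGroup (GL {i // c i = a} F) := by
  haveI : IsTopologicalRing F := inferInstance
  haveI := nonarchimedeanGroup_gl F (Fintype.card {i // c i = a})
  let e : GL (Fin (Fintype.card {i // c i = a})) F ≃* GL {i // c i = a} F := reindexGL (k := F) (blockEnum c a).toEquiv
  have he : Continuous e :=
    Units.continuous_map (f := (Matrix.reindexAlgEquiv F F (blockEnum c a).toEquiv).toMulEquiv.toMonoidHom)
      (continuous_id.matrix_reindex _ _)
  have he' : Continuous e.symm :=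
    Units.continuous_map (f := (Matrix.reindexAlgEquiv F F (blockEnum c a).toEquiv.symm).toMulEquiv.toMonoidHom)
      (continuous_id.matrix_reindex _ _)
  refine ⟨fun U hU => ?_⟩
  have hU' : e ⁻¹' U ∈ 𝓝 (1 : GL (Fin (Fintype.card {i // c i = a})) F) := by
    refine he.continuousAt.preimage_mem_nhds ?_
    rwa [map_one]
  obtain ⟨V, hV⟩ := NonarchimedeanGroup.is_nonarchimedean _ hU'
  have hopen : IsOpen (((V : Subgroup _).map e.toMonoidHom : Subgroup (GL {i // c i = a} F)) : Set (GL {i // c i = a} F)) := by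
    have : (((V : Subgroup _).map e.toMonoidHom : Subgroup (GL {i // c i = a} F)) : Set (GL {i // c i = a} F)) =
        e.symm ⁻¹' (V : Set (GL (Fin (Fintype.card {i // c i = a})) F)) := by
      ext g
      simp only [Subgroup.coe_map, MulEquiv.coe_toMonoidHom, Set.mem_image, SetLike.mem_coe, Set.mem_preimage]
      constructor
      · rintro ⟨x, hx, rfl⟩
        simpa using hx
      · intro hg
        exact ⟨e.symm g, hg, e.apply_symm_apply g⟩
    rw [this]
    exact V.isOpen.preimage he'
  refine ⟨⟨(V : Subgroup _).map e.toMonoidHom, hopen⟩, ?_⟩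
  rintro _ ⟨x, hx, rfl⟩
  exact hV hx

/-- **The standard Levi `Π_a GL(B_a, F)` is a nonarchimedean topological group**: a neighbourhood
of `1` contains a box of neighbourhoods, each containing an open subgroup of its block. A theorem to
be invoked with `haveI` (like `nonarchimedeanGroup_gl`). [folklore] -/
theorem nonarchimedeanGroup_levi : NonarchimedeanGroup (Π a : Fin r, GL {i // c i = a} F) := by
  haveI : ∀ a, NonarchimedeanGroup (GL {i // c i = a} F) := fun a => nonarchimedeanGroup_block F c a
  refine ⟨fun U hU => ?_⟩
  rw [nhds_pi, Filter.mem_pi'] at hU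
  obtain ⟨I, t, ht, hsub⟩ := hU
  choose V hV using fun a => NonarchimedeanGroup.is_nonarchimedean (t a) (ht a)
  have hopen : IsOpen ((Subgroup.pi Set.univ fun a => (V a : Subgroup (GL {i // c i = a} F))) :
      Set (Π a : Fin r, GL {i // c i = a} F)) := by
    rw [Subgroup.coe_pi]
    exact isOpen_set_pi Set.finite_univ fun a _ => (V a).isOpen
  refine ⟨⟨Subgroup.pi Set.univ fun a => (V a : Subgroup (GL {i // c i = a} F)), hopen⟩, fun x hx => hsub ?_⟩
  intro a _
  exact hV a (hx a (Set.mem_univ a))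

end Nonarchimedean

end Literature.NumberTheory.Automorphic
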